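import Mathlib
import Summits.ResolutionOfSingularities.ResolutionOfSingularities.Theorems.RadicialJungCleanModelsCleanLU3ArcCore
import Summits.ResolutionOfSingularities.ResolutionOfSingularities.Theorems.RadicialJungCleanModelsCleanLU3ArcPrelims
import Summits.ResolutionOfSingularities.ResolutionOfSingularities.Theorems.RadicialJungCleanModelsCleanLU3ArcPackage
import Literature.AlgebraicGeometry.Resolution.TranscendenceDefect
import HarnessLib

/-!
# Route `RadicialJung`, crux `CleanModels` (stmt-15917), stub `stub_cleanLU3Defect`: **class (A) with a finite residue
# tower is DISCHARGED** — clean LU along a discrete rank-one valuation whose residue field is finitely generated over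
# that of the centre, for `g₀` without best `p`-th-power approximation, given a derivation moving `g₀`

Line `Sketch` rev 19 of crux stmt-ResolutionOfSingularities-15917 (memo `Cruxes/CleanModels/Lines/Sketch-memo-defect-residue.md`,
class (A) «arcs»); lead `res-B-lead-1` g3.  OURS; nothing here proves resolution in characteristic `p`.
`cleanLU3Defect_of_discrete_of_finiteResidue`: the data of `stub_cleanLU3Defect` PLUS (i) `π ≠ 0` whose value bounds every
value `< 1` and whose powers go below every value (discrete rank one), (ii) a finite `S ⊆ O` such that `locAtCentre A O`
and `S` attain every residue of `O` (finite residue tower), (iii) a derivation `D` of `K` with `D g₀ ≠ 0` and `s • D`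
(`s ≠ 0`) preserving `A` — give the stub's conclusion in loose clean form (3): climb the quadratic sequence
(✓ `exists_quadraticSeq_package`) until `π`, `S` are absorbed (✓ exhaustion), deepen an r.s.p. `(π, y, z)` into arc
coordinates and approximate `h = b^p g₀` by `c^p` from the same ring (✓ density), transport `D`, apply ✓ `arc_core`
(p681465).  Over an algebraically closed ground field this is ALL of class (A).
-/

noncomputable section

set_option linter.dupNamespace false -- mandated namespace of this single-conjunct summit

open IsLocalRing
open Literature.AlgebraicGeometry.Resolution

namespace Summit.ResolutionOfSingularities.ResolutionOfSingularities.Theorems.RadicialJung.CleanModels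

variable {k K : Type} [Field k] [Field K] [Algebra k K]

/-! ## Small algebra -/

/-- If `𝔪 = (x₀, x₁, x₂)` and `π = a₀ x₀ + a₁ x₁ + a₂ x₂` with `a₀` a unit, then `𝔪 = (π, x₁, x₂)`. [folklore] -/
theorem span_triple_exchange {S : Type*} [CommRing S] [IsLocalRing S] (x₀ x₁ x₂ π a₀ a₁ a₂ : S)
    (hm : maximalIdeal S = Ideal.span {x₀, x₁, x₂}) (hπ : π = a₀ * x₀ + a₁ * x₁ + a₂ * x₂) (ha : IsUnit a₀) :
    maximalIdeal S = Ideal.span {π, x₁, x₂} := by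
  obtain ⟨a', rfl⟩ := ha
  rw [hm]
  apply le_antisymm
  · rw [Ideal.span_le]
    rintro t ht
    simp only [Set.mem_insert_iff, Set.mem_singleton_iff] at ht
    rcases ht with rfl | rfl | rfl
    · rw [SetLike.mem_coe, mem_span_triple_iff]
      refine ⟨↑a'⁻¹, -(↑a'⁻¹ * a₁), -(↑a'⁻¹ * a₂), ?_⟩
      rw [hπ]
      have : (↑a'⁻¹ : S) * (↑a' : S) = 1 := Units.inv_mul a'
      linear_combination (-(t : S)) * this
    · exact Ideal.subset_span (by simp)
    · exact Ideal.subset_span (by simp)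
  · rw [Ideal.span_le]
    rintro t ht
    simp only [Set.mem_insert_iff, Set.mem_singleton_iff] at ht
    rcases ht with rfl | rfl | rfl
    · rw [hπ]
      refine Ideal.add_mem _ (Ideal.add_mem _ ?_ ?_) ?_
      · exact Ideal.mul_mem_left _ _ (Ideal.subset_span (by simp))
      · exact Ideal.mul_mem_left _ _ (Ideal.subset_span (by simp))
      · exact Ideal.mul_mem_left _ _ (Ideal.subset_span (by simp))
    · exact Ideal.subset_span (by simp)
    · exact Ideal.subset_span (by simp)

/-- In a local ring with `𝔪 = (x₀, x₁, x₂)`, an element `π ∈ 𝔪 ∖ 𝔪²` is part of a generating triple `(π, y, z)` of `𝔪`.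
[folklore] -/
theorem exists_span_triple_of_not_mem_sq {S : Type*} [CommRing S] [IsLocalRing S] (x₀ x₁ x₂ π : S)
    (hm : maximalIdeal S = Ideal.span {x₀, x₁, x₂}) (hπ : π ∈ maximalIdeal S) (hπ2 : π ∉ maximalIdeal S ^ 2) :
    ∃ y z : S, y ∈ maximalIdeal S ∧ z ∈ maximalIdeal S ∧ maximalIdeal S = Ideal.span {π, y, z} := by
  have hx : x₀ ∈ maximalIdeal S ∧ x₁ ∈ maximalIdeal S ∧ x₂ ∈ maximalIdeal S := by
    rw [hm]; exact ⟨Ideal.subset_span (by simp), Ideal.subset_span (by simp), Ideal.subset_span (by simp)⟩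
  obtain ⟨hx₀, hx₁, hx₂⟩ := hx
  rw [hm] at hπ
  obtain ⟨a₀, a₁, a₂, hπeq⟩ := (mem_span_triple_iff x₀ x₁ x₂ π).mp hπ
  by_cases h₀ : IsUnit a₀
  · exact ⟨x₁, x₂, hx₁, hx₂, span_triple_exchange x₀ x₁ x₂ π a₀ a₁ a₂ hm hπeq h₀⟩
  by_cases h₁ : IsUnit a₁
  · refine ⟨x₀, x₂, hx₀, hx₂, span_triple_exchange x₁ x₀ x₂ π a₁ a₀ a₂ ?_ ?_ h₁⟩
    · rw [hm, Set.insert_comm]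
    · rw [hπeq]; ring
  by_cases h₂ : IsUnit a₂
  · refine ⟨x₁, x₀, hx₁, hx₀, span_triple_exchange x₂ x₁ x₀ π a₂ a₁ a₀ ?_ ?_ h₂⟩
    · rw [hm, Set.insert_comm x₀ x₁, Set.pair_comm x₀ x₂, Set.insert_comm x₁ x₂]
    · rw [hπeq]; ring
  refine absurd ?_ hπ2
  have hm' : ∀ a : S, ¬ IsUnit a → a ∈ maximalIdeal S := fun a ha => (mem_maximalIdeal _).mpr (mem_nonunits_iff.mpr ha)
  rw [hπeq, pow_two]
  exact Ideal.add_mem _ (Ideal.add_mem _ (Ideal.mul_mem_mul (hm' _ h₀) hx₀) (Ideal.mul_mem_mul (hm' _ h₁) hx₁))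
    (Ideal.mul_mem_mul (hm' _ h₂) hx₂)

/-- Along a dominated local subring, elements of `𝔪²` have value `≤ (v π)²` when `v π` bounds every value `< 1`. [folklore] -/
theorem valuation_le_sq_of_mem_sq {O : ValuationSubring K} {R : Subring K} [IsLocalRing R]
    (hdom : SubringDominates R O.toSubring) (π : K) (hπ : ∀ x : K, O.valuation x < 1 → O.valuation x ≤ O.valuation π)
    (m : R) (hm : m ∈ maximalIdeal R ^ 2) : O.valuation (m : K) ≤ O.valuation π ^ 2 := by
  have hmem : ∀ a : R, a ∈ maximalIdeal R ↔ O.valuation (a : K) < 1 := (subringDominates_valuationSubring_iff hdom.1).mp hdom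
  rw [pow_two] at hm
  refine Submodule.mul_induction_on hm (fun a ha b hb => ?_) (fun a b ha hb => ?_)
  · rw [Subring.coe_mul, map_mul, pow_two]
    exact mul_le_mul' (hπ _ ((hmem a).mp ha)) (hπ _ ((hmem b).mp hb))
  · rw [Subring.coe_add]
    exact (Valuation.map_add _ _ _).trans (max_le ha hb)

/-- The representative `(-c/π^{m'})^p · 1 + (b/π^{m'})^p · g₀` of the `K^p`-line of `g₀` equals `(b^p g₀ - c^p)/π^{p m'}`,
as a sum over `Fin p`. [folklore] -/
theorem sum_rep_eq {p : ℕ} [hp : Fact p.Prime] [CharP K p] (g₀ b c π : K) (m' : ℕ) :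
    (∑ j : Fin p, (fun j : Fin p => if (j : ℕ) = 0 then -c / π ^ m' else if (j : ℕ) = 1 then b / π ^ m' else 0) j ^ p *
        g₀ ^ (j : ℕ)) = (b ^ p * g₀ - c ^ p) / π ^ (p * m') := by
  let i₀ : Fin p := ⟨0, hp.out.pos⟩
  let i₁ : Fin p := ⟨1, hp.out.one_lt⟩
  rw [Finset.sum_eq_add i₀ i₁ (by simp [i₀, i₁, Fin.ext_iff])]
  · simp only [i₀, i₁, if_true, one_ne_zero, if_false, pow_zero, mul_one, pow_one]
    rw [div_pow, div_pow, neg_pow, neg_one_pow_char K p, ← pow_mul, mul_comm m' p]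
    ring
  · rintro j - ⟨hj₀, hj₁⟩
    have hj₀' : (j : ℕ) ≠ 0 := fun h => hj₀ (Fin.ext h)
    have hj₁' : (j : ℕ) ≠ 1 := fun h => hj₁ (Fin.ext h)
    simp [hj₀', hj₁', zero_pow hp.out.ne_zero]
  all_goals simp

/-! ## The conclusion from the core -/

/-- Reading the output of `arc_core` as the conclusion of the stub. [folklore] -/
theorem conclusion_of_core {p : ℕ} [hp : Fact p.Prime] [CharP K p] {O : ValuationSubring K} {A A' : Subalgebra k K}
    (hA'O : A'.toSubring ≤ O.toSubring) (hAA' : A ≤ A') (hA'fg : A'.FG)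
    (Rn : Subring K) [IsLocalRing Rn] (hreg : IsRegularLocalRing Rn) (hRn : Rn = locAtCentre A'.toSubring O)
    (g₀ b c π : K) (hb : b ≠ 0) (hπ0 : π ≠ 0) (m' : ℕ)
    (G : Rn) (hGm : G ∈ maximalIdeal Rn) (hGm2 : G ∉ maximalIdeal Rn ^ 2) (hG : (G : K) = (b ^ p * g₀ - c ^ p) / π ^ (p * m')) :
    ∃ (A' : Subalgebra k K), A'.toSubring ≤ O.toSubring ∧ A ≤ A' ∧ A'.FG ∧
    ∃ (_ : IsRegularLocalRing (locAtCentre A'.toSubring O)) (c : Fin p → K), (∃ j : Fin p, (j : ℕ) ≠ 0 ∧ c j ≠ 0) ∧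
    ((∃ (d m : ℕ) (hmd : m ≤ d) (t : Fin d → ↥(locAtCentre A'.toSubring O)) (a : Fin m → ℕ) (u : ↥(locAtCentre A'.toSubring O)), IsUnit u ∧
    Ideal.span (Set.range t) = IsLocalRing.maximalIdeal ↥(locAtCentre A'.toSubring O) ∧
    ringKrullDim ↥(locAtCentre A'.toSubring O) = (d : WithBot ℕ∞) ∧ 0 < m ∧ (∀ i, ¬ p ∣ a i) ∧
    (∑ j : Fin p, c j ^ p * g₀ ^ (j : ℕ)) = (u : K) * ∏ i : Fin m, ((t (Fin.castLE hmd i) : ↥(locAtCentre A'.toSubring O)) : K) ^ (a i)) ∨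
    (∃ u : ↥(locAtCentre A'.toSubring O), IsUnit u ∧ (∑ j : Fin p, c j ^ p * g₀ ^ (j : ℕ)) = (u : K) ∧
    ∀ c' : ↥(locAtCentre A'.toSubring O), u - c' ^ p ∉ IsLocalRing.maximalIdeal ↥(locAtCentre A'.toSubring O)) ∨
    (∃ s c' : ↥(locAtCentre A'.toSubring O), (∑ j : Fin p, c j ^ p * g₀ ^ (j : ℕ)) = (s : K) ∧
    s - c' ^ p ∈ IsLocalRing.maximalIdeal ↥(locAtCentre A'.toSubring O) ∧
    s - c' ^ p ∉ IsLocalRing.maximalIdeal ↥(locAtCentre A'.toSubring O) ^ 2)) := by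
  subst hRn
  refine ⟨A', hA'O, hAA', hA'fg, hreg,
    fun j : Fin p => if (j : ℕ) = 0 then -c / π ^ m' else if (j : ℕ) = 1 then b / π ^ m' else 0, ?_, ?_⟩
  · refine ⟨⟨1, hp.out.one_lt⟩, one_ne_zero, ?_⟩
    simp only [one_ne_zero, if_false, if_true]
    exact div_ne_zero hb (pow_ne_zero _ hπ0)
  · refine Or.inr (Or.inr ⟨G, 0, ?_, ?_, ?_⟩)
    · rw [sum_rep_eq, hG]
    · rw [zero_pow hp.out.ne_zero, sub_zero]; exact hGm
    · rw [zero_pow hp.out.ne_zero, sub_zero]; exact hGm2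

/-! ## The wrapper -/

/-- **Class (A) with a finite residue tower is discharged.**  See the module docstring. [folklore] -/
theorem cleanLU3Defect_of_discrete_of_finiteResidue :
    ∀ (p : ℕ), p.Prime →
    ∀ (k : Type) [Field k] [CharP k p] (K : Type) [Field K] [Algebra k K]
    (O : ValuationSubring K) (A : Subalgebra k K), A.toSubring ≤ O.toSubring → A.FG → IsFractionRing A K →
    ringKrullDim A ≤ 3 → IsRegularLocalRing (locAtCentre A.toSubring O) →
    ringKrullDim (locAtCentre A.toSubring O) = 3 →
    (∀ (T : Subring K) (hT : T ≤ O.toSubring), A.toSubring ≤ T → (subringCentre T O hT).IsMaximal) →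
    ∀ g₀ : K, (∀ c : K, c ^ p ≠ g₀) →
    (∀ f₀ : K, ∃ f₁ : K, O.valuation (g₀ - f₁ ^ p) < O.valuation (g₀ - f₀ ^ p)) →
    (∀ hk : ∀ c : k, algebraMap k K c ∈ O, transcendenceDefect k O hk ≠ 0) →
    -- class (A), finite residue tower, derivation:
    (∃ π : K, π ≠ 0 ∧ (∀ x : K, O.valuation x < 1 → O.valuation x ≤ O.valuation π) ∧
      (∀ x : K, x ≠ 0 → ∃ n : ℕ, O.valuation π ^ n ≤ O.valuation x)) →
    (∃ S : Finset K, (↑S : Set K) ⊆ O ∧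
      ∀ y : K, y ∈ O → ∃ r : K, r ∈ Subring.closure ((locAtCentre A.toSubring O : Set K) ∪ ↑S) ∧ O.valuation (y - r) < 1) →
    (∃ (D : Derivation ℤ K K) (s : K), s ≠ 0 ∧ (∀ y : K, y ∈ A → s * D y ∈ A) ∧ D g₀ ≠ 0) →
    ∃ (A' : Subalgebra k K), A'.toSubring ≤ O.toSubring ∧ A ≤ A' ∧ A'.FG ∧
    ∃ (_ : IsRegularLocalRing (locAtCentre A'.toSubring O)) (c : Fin p → K), (∃ j : Fin p, (j : ℕ) ≠ 0 ∧ c j ≠ 0) ∧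
    ((∃ (d m : ℕ) (hmd : m ≤ d) (t : Fin d → ↥(locAtCentre A'.toSubring O)) (a : Fin m → ℕ) (u : ↥(locAtCentre A'.toSubring O)), IsUnit u ∧
    Ideal.span (Set.range t) = IsLocalRing.maximalIdeal ↥(locAtCentre A'.toSubring O) ∧
    ringKrullDim ↥(locAtCentre A'.toSubring O) = (d : WithBot ℕ∞) ∧ 0 < m ∧ (∀ i, ¬ p ∣ a i) ∧
    (∑ j : Fin p, c j ^ p * g₀ ^ (j : ℕ)) = (u : K) * ∏ i : Fin m, ((t (Fin.castLE hmd i) : ↥(locAtCentre A'.toSubring O)) : K) ^ (a i)) ∨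
    (∃ u : ↥(locAtCentre A'.toSubring O), IsUnit u ∧ (∑ j : Fin p, c j ^ p * g₀ ^ (j : ℕ)) = (u : K) ∧
    ∀ c' : ↥(locAtCentre A'.toSubring O), u - c' ^ p ∉ IsLocalRing.maximalIdeal ↥(locAtCentre A'.toSubring O)) ∨
    (∃ s c' : ↥(locAtCentre A'.toSubring O), (∑ j : Fin p, c j ^ p * g₀ ^ (j : ℕ)) = (s : K) ∧
    s - c' ^ p ∈ IsLocalRing.maximalIdeal ↥(locAtCentre A'.toSubring O) ∧
    s - c' ^ p ∉ IsLocalRing.maximalIdeal ↥(locAtCentre A'.toSubring O) ^ 2)) := by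
  intro p hp k _ _ K _ _ O A hAO hAfg hfrac _ hreg hdim3 hzd g₀ _ hdefect _ ⟨π, hπ0, hπ, harch⟩ ⟨S, hSO, hres⟩
    ⟨D, s, hs0, hDA, hDg⟩
  classical
  haveI : Fact p.Prime := ⟨hp⟩
  haveI : CharP K p := charP_of_injective_algebraMap (algebraMap k K).injective p
  -- (0) the quadratic sequence package
  have hd : ringKrullDim (locAtCentre A.toSubring O) ≠ 0 := by
    intro h0; rw [hdim3] at h0; exact absurd h0 (by decide)
  obtain ⟨R, hR0, hstep, hregR, hdimR, hmodel⟩ := exists_quadraticSeq_package A O hAO hAfg hreg hd hzd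
  haveI hRloc : ∀ i, IsLocalRing (R i) := fun i => by haveI := hregR i; infer_instance
  have h0dom : SubringDominates (R 0) O.toSubring := by rw [hR0]; exact subringDominates_locAtCentre hAO
  have hdom : ∀ i, SubringDominates (R i) O.toSubring := fun i => (sequence_dominates h0dom hstep i).1
  have hmono : ∀ {i j : ℕ}, i ≤ j → R i ≤ R j := fun hij => sequence_monotone hstep hij
  have hof : IsLocalRingOf (R 0) := by rw [hR0]; exact isLocalRingOf_locAtCentre A O hAO
  have hdim3R : ∀ i, ringKrullDim (R i) = 3 := fun i => (hdimR i).trans hdim3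
  have hAR0 : A.toSubring ≤ R 0 := by rw [hR0]; exact le_locAtCentre _ O
  have hmemR : ∀ i (a : R i), a ∈ maximalIdeal (R i) ↔ O.valuation (a : K) < 1 := fun i =>
    (subringDominates_valuationSubring_iff (hdom i).1).mp (hdom i)
  -- (1) `h = b^p g₀ ∈ A`
  obtain ⟨a, b, hb, hab⟩ := IsFractionRing.div_surjective (A := A) g₀
  have hab' : (a : K) / (b : K) = g₀ := hab
  have hb0 : (b : K) ≠ 0 := fun h => nonZeroDivisors.ne_zero hb (Subtype.ext h)
  set h : K := (b : K) ^ p * g₀ with hhdef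
  have hhA : h ∈ A := by
    have : h = (a : K) * (b : K) ^ (p - 1) := by
      obtain ⟨q, hq⟩ : ∃ q, p = q + 1 := ⟨p - 1, (Nat.sub_add_cancel hp.one_lt.le).symm⟩
      rw [hhdef, ← hab', hq, Nat.add_sub_cancel, pow_succ]
      field_simp
    rw [this]
    exact A.mul_mem a.2 (A.pow_mem b.2 _)
  -- `v π < 1`, `π ∈ O`
  have hne0 : maximalIdeal (R 0) ≠ ⊥ := by
    intro hbot
    have hfield : IsField (R 0) := IsLocalRing.isField_iff_maximalIdeal_eq.mpr hbot
    have h0 : ringKrullDim (R 0) = 0 := ringKrullDim_eq_zero_of_isField hfield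
    rw [hdim3R] at h0; exact absurd h0 (by decide)
  obtain ⟨m₀, hm₀m, hm₀0⟩ := Submodule.exists_mem_ne_zero_of_ne_bot hne0
  have hvπ : O.valuation π < 1 := by
    have hvm : O.valuation (m₀ : K) < 1 := (hmemR 0 m₀).mp hm₀m
    have hm0' : (m₀ : K) ≠ 0 := fun h0 => hm₀0 (Subtype.ext h0)
    obtain ⟨n, hn⟩ := harch _ hm0'
    by_contra hge
    push Not at hge
    have : (1 : O.ValueGroup) ≤ O.valuation π ^ n := one_le_pow₀ hge
    exact absurd (this.trans hn) (not_le.mpr hvm)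
  have hπO : π ∈ O := by rw [← O.valuation_le_one_iff]; exact hvπ.le
  have hvπpos : 0 < O.valuation π := zero_lt_iff.mpr ((Valuation.ne_zero_iff _).mpr hπ0)
  have hanti : ∀ {i j : ℕ}, i ≤ j → O.valuation π ^ j ≤ O.valuation π ^ i := fun hij =>
    pow_le_pow_right_of_le_one' hvπ.le hij
  -- (2) transport of the derivation
  have hD0 : ∀ y ∈ R 0, s * D y ∈ R 0 := by
    rw [hR0]
    exact mul_derivation_mem_locAtCentre D s (B := A.toSubring) (O := O) (fun y hy => hDA y hy)
  have hDer := exists_derivation_preserving_seq R hstep D s hs0 hD0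
  -- (3) climb until `π` and `S` are absorbed
  have hexh : ∀ z : K, z ∈ O → ∃ i, z ∈ R i := fun z hz =>
    exists_mem_of_quadraticTransforms_of_discrete O R hof h0dom hstep π hπ harch z hz
  have hfin : ∀ T : Finset K, (↑T : Set K) ⊆ O → ∃ i, ∀ z ∈ T, z ∈ R i := by
    intro T
    induction T using Finset.induction_on with
    | empty => intro _; exact ⟨0, fun z hz => absurd hz (Finset.notMem_empty z)⟩
    | insert z T hzT ih =>
      intro hsub
      rw [Finset.coe_insert] at hsub
      obtain ⟨i, hi⟩ := ih (fun w hw => hsub (Set.mem_insert_of_mem _ hw))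
      obtain ⟨j, hj⟩ := hexh z (hsub (Set.mem_insert _ _))
      refine ⟨max i j, fun w hw => ?_⟩
      rcases Finset.mem_insert.mp hw with rfl | hw
      · exact hmono (le_max_right _ _) hj
      · exact hmono (le_max_left _ _) (hi w hw)
  obtain ⟨n₁, hn₁⟩ := hfin (insert π S) (by
    rw [Finset.coe_insert]; exact Set.insert_subset hπO hSO)
  have hπn₁ : π ∈ R n₁ := hn₁ π (Finset.mem_insert_self _ _)
  have hSn₁ : ∀ z ∈ S, z ∈ R n₁ := fun z hz => hn₁ z (Finset.mem_insert_of_mem hz)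
  -- the restarted sequence
  let R' : ℕ → Subring K := fun i => R (n₁ + i)
  haveI hR'loc : ∀ i, IsLocalRing (R' i) := fun i => hRloc (n₁ + i)
  have hstep' : ∀ i, IsQuadraticTransformAlong O (R' i) (R' (i + 1)) := fun i => by
    change IsQuadraticTransformAlong O (R (n₁ + i)) (R (n₁ + (i + 1)))
    rw [← add_assoc]; exact hstep (n₁ + i)
  have hreg' : ∀ i, IsRegularLocalRing (R' i) := fun i => hregR (n₁ + i)
  have hdim' : ∀ i, ringKrullDim (R' i) = 3 := fun i => hdim3R (n₁ + i)
  have h0' : SubringDominates (R' 0) O.toSubring := hdom (n₁ + 0)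
  -- density of `B = R n₁` in `O`
  have hres' : ∀ y : K, y ∈ O → ∃ r : K, r ∈ R n₁ ∧ O.valuation (y - r) < 1 := by
    intro y hy
    obtain ⟨r, hr, hv⟩ := hres y hy
    refine ⟨r, ?_, hv⟩
    have hle : Subring.closure ((locAtCentre A.toSubring O : Set K) ∪ ↑S) ≤ R n₁ := by
      rw [Subring.closure_le]
      rintro w (hw | hw)
      · exact hmono (Nat.zero_le n₁) (hR0 ▸ hw)
      · exact hSn₁ w hw
    exact hle hr
  -- (4) arc coordinates at `B = R n₁`
  haveI : IsRegularLocalRing (R n₁) := hregR n₁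
  have hBdom := hdom n₁
  obtain ⟨x, hx⟩ := exists_regularSystemOfParameters (R := R n₁)
  have hsf : (maximalIdeal (R n₁)).spanFinrank = 3 := by
    have e := IsRegularLocalRing.spanFinrank_maximalIdeal (R := R n₁)
    rw [hdim3R] at e; exact_mod_cast e
  let x' : Fin 3 → R n₁ := fun j => x (Fin.cast hsf.symm j)
  have hx' : maximalIdeal (R n₁) = Ideal.span {x' 0, x' 1, x' 2} := by
    rw [← hx]
    have hr : Set.range x = Set.range x' := by
      ext t
      simp only [Set.mem_range, x']
      constructor
      · rintro ⟨i, rfl⟩; exact ⟨Fin.cast hsf i, by simp⟩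
      · rintro ⟨j, rfl⟩; exact ⟨Fin.cast hsf.symm j, rfl⟩
    rw [hr]
    congr 1
    ext t
    simp only [Set.mem_range, Set.mem_insert_iff, Set.mem_singleton_iff]
    constructor
    · rintro ⟨i, rfl⟩; fin_cases i <;> simp
    · rintro (rfl | rfl | rfl)
      exacts [⟨0, rfl⟩, ⟨1, rfl⟩, ⟨2, rfl⟩]
  have hπm : (⟨π, hπn₁⟩ : R n₁) ∈ maximalIdeal (R n₁) := (hmemR n₁ _).mpr hvπ
  have hπm2 : (⟨π, hπn₁⟩ : R n₁) ∉ maximalIdeal (R n₁) ^ 2 := by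
    intro h2
    have hle := valuation_le_sq_of_mem_sq hBdom π hπ _ h2
    change O.valuation π ≤ O.valuation π ^ 2 at hle
    rw [pow_two] at hle
    have : O.valuation π * 1 ≤ O.valuation π * O.valuation π := by rwa [mul_one]
    exact absurd (le_of_mul_le_mul_left this hvπpos) (not_le.mpr hvπ)
  obtain ⟨y, z, hym, hzm, hmyz⟩ := exists_span_triple_of_not_mem_sq (x' 0) (x' 1) (x' 2) ⟨π, hπn₁⟩ hx' hπm hπm2
  -- the derivation at stage `n₁` and the order `oD`
  obtain ⟨s₁, hs₁0, hD₁⟩ := hDer n₁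
  have hDh : D h = (b : K) ^ p * D g₀ := by
    rw [hhdef, Derivation.leibniz, Derivation.leibniz_pow]
    simp [smul_eq_mul, nsmul_eq_mul]
  have hEh0 : s₁ * D h ≠ 0 := mul_ne_zero hs₁0 (by rw [hDh]; exact mul_ne_zero (pow_ne_zero _ hb0) hDg)
  have hhR : h ∈ R n₁ := hmono (Nat.zero_le n₁) (hAR0 hhA)
  have hEhO : s₁ * D h ∈ O := (hdom n₁).1 (hD₁ h hhR)
  obtain ⟨oD, hoD⟩ := exists_valuation_eq_pow_of_discrete O π hπ harch (s₁ * D h) hEh0 hEhO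
  -- depth
  set M : ℕ := 2 * oD + p + 2 with hMdef
  -- deepen `y`, `z`
  have hvy : O.valuation (y : K) ≤ O.valuation π := hπ _ ((hmemR n₁ y).mp hym)
  have hvz : O.valuation (z : K) ≤ O.valuation π := hπ _ ((hmemR n₁ z).mp hzm)
  obtain ⟨ry, hry, hvu⟩ := exists_approx_mul_of_dense hπn₁ hπ0 hπ hres' M (y : K) hvy
  obtain ⟨rz, hrz, hvw⟩ := exists_approx_mul_of_dense hπn₁ hπ0 hπ hres' M (z : K) hvz
  set u : K := (y : K) - π * ry with hudef
  set w : K := (z : K) - π * rz with hwdef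
  have huR : u ∈ R n₁ := (R n₁).sub_mem y.2 ((R n₁).mul_mem hπn₁ hry)
  have hwR : w ∈ R n₁ := (R n₁).sub_mem z.2 ((R n₁).mul_mem hπn₁ hrz)
  have hu : O.valuation u ≤ O.valuation π ^ M := hvu.trans (hanti (Nat.le_succ M))
  have hw : O.valuation w ≤ O.valuation π ^ M := hvw.trans (hanti (Nat.le_succ M))
  have hm : maximalIdeal (R n₁) = Ideal.span {(⟨π, hπn₁⟩ : R n₁), ⟨u, huR⟩, ⟨w, hwR⟩} := by
    rw [hmyz]
    have hyu : y = ⟨u, huR⟩ + ⟨π, hπn₁⟩ * ⟨ry, hry⟩ := Subtype.ext (by change (y : K) = u + π * ry; rw [hudef]; ring)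
    have hzw : z = ⟨w, hwR⟩ + ⟨π, hπn₁⟩ * ⟨rz, hrz⟩ := Subtype.ext (by change (z : K) = w + π * rz; rw [hwdef]; ring)
    apply le_antisymm
    · rw [Ideal.span_le]
      rintro t ht
      simp only [Set.mem_insert_iff, Set.mem_singleton_iff] at ht
      rcases ht with rfl | rfl | rfl
      · exact Ideal.subset_span (by simp)
      · rw [SetLike.mem_coe, hyu]
        exact Ideal.add_mem _ (Ideal.subset_span (by simp)) (Ideal.mul_mem_right _ _ (Ideal.subset_span (by simp)))
      · rw [SetLike.mem_coe, hzw]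
        exact Ideal.add_mem _ (Ideal.subset_span (by simp)) (Ideal.mul_mem_right _ _ (Ideal.subset_span (by simp)))
    · rw [Ideal.span_le]
      rintro t ht
      simp only [Set.mem_insert_iff, Set.mem_singleton_iff] at ht
      rcases ht with rfl | rfl | rfl
      · exact Ideal.subset_span (by simp)
      · have : (⟨u, huR⟩ : R n₁) = y - ⟨π, hπn₁⟩ * ⟨ry, hry⟩ := by rw [hyu]; ring
        rw [SetLike.mem_coe, this]
        exact Ideal.sub_mem _ (Ideal.subset_span (by simp)) (Ideal.mul_mem_right _ _ (Ideal.subset_span (by simp)))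
      · have : (⟨w, hwR⟩ : R n₁) = z - ⟨π, hπn₁⟩ * ⟨rz, hrz⟩ := by rw [hzw]; ring
        rw [SetLike.mem_coe, this]
        exact Ideal.sub_mem _ (Ideal.subset_span (by simp)) (Ideal.mul_mem_right _ _ (Ideal.subset_span (by simp)))
  -- (5) the approximant `c ∈ R n₁`
  obtain ⟨f, hf⟩ := exists_approx_le_pow_of_forall_exists_lt O π hπ g₀ hdefect hp.ne_zero M
  have hvh1 : O.valuation h ≤ 1 := (O.valuation_le_one_iff _).mpr (hAO hhA)
  set f' : K := (b : K) * f with hf'def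
  have hprec₁ : O.valuation (h - f' ^ p) ≤ O.valuation π ^ M := by
    have : h - f' ^ p = (b : K) ^ p * (g₀ - f ^ p) := by rw [hhdef, hf'def]; ring
    rw [this, map_mul]
    calc O.valuation ((b : K) ^ p) * O.valuation (g₀ - f ^ p)
        ≤ O.valuation ((b : K) ^ p) * (O.valuation π ^ M * O.valuation g₀) := mul_le_mul_right hf _
      _ = O.valuation π ^ M * O.valuation h := by rw [hhdef, map_mul, mul_left_comm]
      _ ≤ O.valuation π ^ M * 1 := mul_le_mul_right hvh1 _
      _ = O.valuation π ^ M := mul_one _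
  have hf'O : f' ∈ O := by
    rw [← O.valuation_le_one_iff]
    have hp' : O.valuation (f' ^ p) ≤ 1 := by
      have : f' ^ p = h - (h - f' ^ p) := by ring
      rw [this]
      refine (Valuation.map_sub _ _ _).trans (max_le hvh1 (hprec₁.trans ?_))
      exact pow_le_one₀ zero_le hvπ.le
    rw [map_pow] at hp'
    exact (pow_le_one_iff_of_nonneg zero_le hp.ne_zero).mp hp'
  obtain ⟨c, hcR, hvc⟩ := exists_approx_of_dense hπn₁ hπ hres' M f' hf'O
  have hprec : O.valuation (h - c ^ p) ≤ O.valuation π ^ M := by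
    have e : h - c ^ p = (h - f' ^ p) + (f' - c) ^ p := by rw [sub_pow_char f' c]; ring
    rw [e]
    refine (Valuation.map_add _ _ _).trans (max_le hprec₁ ?_)
    rw [map_pow]
    calc O.valuation (f' - c) ^ p ≤ O.valuation (f' - c) := pow_le_of_le_one zero_le
          (hvc.trans (pow_le_one₀ zero_le hvπ.le)) hp.ne_zero
      _ ≤ O.valuation π ^ M := hvc
  -- (6) the core
  have hcore := arc_core (O := O) (p := p) R' hreg' hdim' h0' hstep' π u w hπn₁ huR hwR hm hπ0 hπ D s₁ hD₁ h c hhR hcR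
    oD M hoD le_rfl hu hw hprec
  obtain ⟨n, m', -, G, hGm, hGm2, hGeq⟩ := hcore
  -- (7) the model of `R (n₁ + n)` and the conclusion
  obtain ⟨A', hA'O, hAA', hA'fg, hRn⟩ := hmodel (n₁ + n)
  exact conclusion_of_core hA'O hAA' hA'fg (R' n) (hreg' n) hRn g₀ (b : K) c π hb0 hπ0 m' G hGm hGm2
    (by rw [hGeq])

end Summit.ResolutionOfSingularities.ResolutionOfSingularities.Theorems.RadicialJung.CleanModels

end
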